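import Literature.MathematicalPhysics.QuantumLattice.AnisotropicHeisenbergThermalTwoSumRule
import Literature.MathematicalPhysics.QuantumLattice.AnisotropicHeisenbergLargeSpinNeelOrder
import Literature.MathematicalPhysics.QuantumLattice.AnisotropicXYLayeredThermalExplicit
import HarnessLib

/-!
# Néel order of the layered spin-`S` Heisenberg antiferromagnet at positive temperature:
# sums to integrals for the Dyson–Lieb–Simon term, the certificate form, and an UNCONDITIONAL
# Néel-temperature floor for large spin with the interlayer logarithm `log(J∥/J⊥)`

Topic `MathematicalPhysics/QuantumLattice`; closes the two eventual hypotheses of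
`heisAniso_thermal_neelLRO_of_certificate` (`AnisotropicHeisenbergThermalTwoSumRule.lean`) by
integrals — `𝓦^K_{t,μ}(2k) → 𝓘^K_{t,μ}` (the tree's `heisAnisoKlsRiemannSum_eventually_le`) and, for
the new thermal sum, `𝓣^K_{1,0}(2k) → C₀(K) = (2π)^{-d}∫dp/E^K_p` (Fröhlich–Israel–Lieb–Simon's
constant, the tree's `AnisotropicRotator.infraredConstant` and `torusSum_inv_anisoDispersion_approx`)
with `𝓣^K_{t,μ} ≤ ({t}₊ + Σᵢ|μᵢ|)·𝓣^K_{1,0}` — and draws the consequences: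

* **`heisAniso_thermal_neelLRO_of_integral_certificate`** — Néel order at inverse temperature `β`
  from finitely many certified bounds `𝓘^K_{tⱼ,μⱼ} < W̄ⱼ`, `({tⱼ}₊ + Σᵢ|μⱼᵢ|)·C₀(K) < T̄ⱼ` and a
  real-arithmetic certificate on the (T)+(Nᵀ) region (the positive-temperature statement announced
  on [KLS1988JSP] p. 1020, in the form that consumes certified numerics; `d ≥ 3`);
* **`heisAniso_thermalNeelOrderParameter_ge_three`** — `d = 3`, every `K > 0` with `2Kᵢ ≤ ΣⱼKⱼ`,
  every spin `S = n/2`, every `β > 0`: along the even tori `(ℤ/(2k+2)ℤ)³`,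
  `liminf |Λ|⁻² Σ_{x,y}(-1)^{x+y}⟨𝐒_x·𝐒_y⟩_β ≥ S(S+1) - 9S/√2 - 3C₀(K)/(2β)`
  — Dyson–Lieb–Simon's Thm. 6.2 (large spin, low temperature) for direction-dependent couplings,
  with the multipliers `(t, μ) = (1, 0)` (total sum rule (2) alone), the analytic bound
  `𝓘^K_{1,0} < 3` of `AnisotropicHeisenbergLargeSpinNeelOrder.lean`, and NO numerical input;
* **`layeredHeis_thermalNeelOrderParameter_ge`**, **`layeredHeis_neelLRO_thermal_largeSpin`** — the
  layered model `K = (1, 1, r)`, `0 < r ≤ 1` ([KLS1988JSP] eq. (5)): `C₀ = C(r) = klsConstant r`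
  `≤ 3 + log(1/r)` (`klsConstant_le`), hence Néel long-range order at inverse temperature `β` for
  every spin `S ≥ 11/2` as soon as `2β(S(S+1) - 9S/√2) > 3(3 + log(1/r))`; in units of the in-plane
  coupling `J∥` (interlayer `J⊥ = rJ∥`) this is the explicit Néel-temperature FLOOR
  `k_BT_N ≥ (2/3)·J∥·(S(S+1) - 9S/√2)/(3 + log(J∥/J⊥))` [arith; e.g. `S = 6`: `T_N ≥ 2.55J∥/(3 + log(J∥/J⊥))`,
  `S = 10`: `T_N ≥ 30.9J∥/(3 + log(J∥/J⊥))`; not asserted in Lean] — the `1/log(J∥/J⊥)` law of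
  quasi-two-dimensional antiferromagnets, rigorously and with a crude constant (`S ≥ 11/2` because
  the spin-wave correction `9S/√2` of the two-sum-rule bound with `W̄ = 3` must be beaten by
  `S(S+1)`; [KLS1988JSP]'s `S = ½`, `r ≥ 0.16` needs the numerical evaluation of (6)–(9) and the
  ground-state energetics `0 ≤ ρ₃ ≤ ρ₁` at `T > 0`, left to the certificate form).

No named fact is introduced; nothing numerical beyond rational arithmetic and the decimal brackets
already used in `AnisotropicHeisenbergLargeSpinNeelOrder.lean`.

## References

* [KLS1988JSP] T. Kennedy, E. H. Lieb, B. S. Shastry, J. Stat. Phys. 53 (1988) 1019–1030, p. 1020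
  ("the techniques we use may be combined with the techniques of Dyson et al. for nonzero
  temperatures to prove the existence of a phase transition for `1 ≥ r ≥ 0.16`"), §3, eqs. (5)–(9).
* [DLS1978] F. J. Dyson, E. H. Lieb, B. Simon, J. Stat. Phys. 18 (1978) 335–383, Thm. 5.1 (the
  constant `C_d`), Thm. 6.2 ("the nearest neighbor, simple cubic antiferromagnet has a phase
  transition at sufficiently low temperature if `ν ≥ 3`, `S = 1, 3/2, …`").
* [FILS1978] J. Fröhlich, R. Israel, E. H. Lieb, B. Simon, Commun. Math. Phys. 62 (1978) 1–34,
  (4.7)–(4.10) (the constant `C₀` for direction-dependent couplings), Thm. 4.7.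
-/

noncomputable section

open MeasureTheory Set Filter Topology Finset
open Literature.MathematicalPhysics.QuantumLattice Literature.Probability.LatticeModels

namespace Literature.MathematicalPhysics.QuantumLattice

variable {d : ℕ}

/-! ### The thermal sum: reduction to `(t, μ) = (1, 0)` and sums to integrals -/

section ThermalSum

/-- The positive part of the multiplier is bounded: `{t + Σᵢμᵢcos qᵢ}₊ ≤ {t}₊ + Σᵢ|μᵢ|`.
[cite: KLS1988JSP, eqs. (6)-(9)] -/
theorem heisAnisoKernel_posPart_le (t : ℝ) (μ : Fin d → ℝ) (L : ℕ) [NeZero L] (q : TorusSite d L) :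
    max (heisAnisoKernel t μ L q) 0 ≤ max t 0 + ∑ i, |μ i| := by
  refine max_le ?_ (by positivity)
  rw [heisAnisoKernel]
  have h : ∑ i, μ i * Real.cos (latticeMomentum L q i) ≤ ∑ i, |μ i| :=
    sum_le_sum fun i _ => (le_abs_self _).trans (by
      rw [abs_mul]
      exact mul_le_of_le_one_right (abs_nonneg _) (Real.abs_cos_le_one _))
  linarith [le_max_left t 0]

/-- The kernel of `(t, μ) = (1, 0)` is `≡ 1`. [cite: KLS1988JSP, eqs. (6)-(9)] -/
theorem heisAnisoKernel_one_zero_posPart (L : ℕ) [NeZero L] (q : TorusSite d L) :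
    max (heisAnisoKernel 1 0 L q) 0 = 1 := by
  rw [heisAnisoKernel]
  simp only [Pi.zero_apply, zero_mul, sum_const_zero, add_zero]
  exact max_eq_left zero_le_one

/-- **Reduction to the total sum rule**: `𝓣^K_{t,μ}(L) ≤ ({t}₊ + Σᵢ|μᵢ|) · 𝓣^K_{1,0}(L)` for `K ≥ 0`.
[cite: DLS1978, Thm. 5.1] [cite: KLS1988JSP, eqs. (6)-(9)] -/
theorem heisAnisoThermalRiemannSum_le_mul_one_zero {K : Fin d → ℝ} (hK : ∀ i, 0 ≤ K i) (t : ℝ)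
    (μ : Fin d → ℝ) (L : ℕ) :
    heisAnisoThermalRiemannSum K t μ L ≤
      (max t 0 + ∑ i, |μ i|) * heisAnisoThermalRiemannSum K 1 0 L := by
  rcases Nat.eq_zero_or_pos L with rfl | hL
  · simp [heisAnisoThermalRiemannSum]
  haveI : NeZero L := ⟨hL.ne'⟩
  rw [heisAnisoThermalRiemannSum_of_neZero, heisAnisoThermalRiemannSum_of_neZero, ← mul_div_assoc,
    mul_sum]
  refine div_le_div_of_nonneg_right (sum_le_sum fun q _ => ?_) (by positivity)
  rw [heisAnisoKernel_one_zero_posPart, div_eq_mul_one_div (max _ 0)]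
  exact mul_le_mul_of_nonneg_right (heisAnisoKernel_posPart_le t μ L q)
    (div_nonneg zero_le_one (heisAniso_anisoDispersion_nonneg hK _))

/-- **`𝓣^K_{1,0}(2k)` is the torus sum `(2k)^{-d} Σ_{p ≠ 0} 1/E^K_p`** of [FILS1978] (4.7)–(4.10)
(the substitution `p = q - Q`). [cite: FILS1978, eq. (4.7)] [cite: DLS1978, Thm. 5.1] -/
theorem heisAnisoThermalRiemannSum_one_zero_eq (K : Fin d → ℝ) (k : ℕ) [NeZero (2 * k)] :
    heisAnisoThermalRiemannSum K 1 0 (2 * k) =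
      1 / ((2 * k : ℕ) : ℝ) ^ d * ∑ p ∈ (univ : Finset (TorusSite d (2 * k))).erase 0,
        1 / NVectorAniso.anisoDispersion K (latticeMomentum (2 * k) p) := by
  rw [heisAnisoThermalRiemannSum_of_neZero, one_div_mul_eq_div,
    ← sum_erase_neelIndex_shift k
      (fun p => 1 / NVectorAniso.anisoDispersion K (latticeMomentum (2 * k) p))]
  refine congrArg (· / ((2 * k : ℕ) : ℝ) ^ d) (sum_congr rfl fun q _ => ?_)
  rw [heisAnisoKernel_one_zero_posPart]

/-- **Sums to integrals for the Dyson–Lieb–Simon term** (`d ≥ 3`, `K > 0`): for every `ε > 0`,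
eventually `𝓣^K_{1,0}(2k) ≤ C₀(K) + ε`, `C₀(K) = (2π)^{-d}∫_{[-π,π]^d} dp/E^K_p`
(`AnisotropicRotator.infraredConstant`, via the tree's `torusSum_inv_anisoDispersion_approx`).
[cite: FILS1978, eqs. (4.7)-(4.10)] [cite: DLS1978, Thm. 5.1] -/
theorem heisAnisoThermalRiemannSum_one_zero_eventually_le (hd3 : 3 ≤ d) {K : Fin d → ℝ}
    (hK : ∀ i, 0 < K i) {ε : ℝ} (hε : 0 < ε) :
    ∀ᶠ k : ℕ in atTop,
      heisAnisoThermalRiemannSum K 1 0 (2 * k) ≤ AnisotropicRotator.infraredConstant K + ε := by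
  obtain ⟨i₀, -, hi₀⟩ := exists_min_image univ K ⟨⟨0, by omega⟩, mem_univ _⟩
  have hm : 0 < K i₀ := hK i₀
  have hmK : ∀ i, K i₀ ≤ K i := fun i => hi₀ i (mem_univ i)
  obtain ⟨L₀, hL₀⟩ := AnisotropicRotator.torusSum_inv_anisoDispersion_approx hd3 hm hmK hε
  filter_upwards [eventually_ge_atTop (L₀ + 1)] with k hk
  haveI : NeZero (2 * k) := ⟨by omega⟩
  have h := hL₀ (2 * k) (even_two_mul k) (by omega)
  rw [abs_le] at h
  rw [heisAnisoThermalRiemannSum_one_zero_eq]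
  linarith [h.2]

/-- Consequently, for general multipliers: if `({t}₊ + Σᵢ|μᵢ|)·C₀(K) < T̄` then eventually
`𝓣^K_{t,μ}(2k) ≤ T̄` (`d ≥ 3`, `K > 0`). [cite: FILS1978, eq. (4.7)] [cite: DLS1978, Thm. 5.1] -/
theorem heisAnisoThermalRiemannSum_eventually_le (hd3 : 3 ≤ d) {K : Fin d → ℝ} (hK : ∀ i, 0 < K i)
    (t : ℝ) (μ : Fin d → ℝ) {Tbar : ℝ}
    (hT : (max t 0 + ∑ i, |μ i|) * AnisotropicRotator.infraredConstant K < Tbar) :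
    ∀ᶠ k : ℕ in atTop, heisAnisoThermalRiemannSum K t μ (2 * k) ≤ Tbar := by
  set M : ℝ := max t 0 + ∑ i, |μ i| with hM_def
  set C : ℝ := AnisotropicRotator.infraredConstant K with hC_def
  have hM : 0 ≤ M := by positivity
  have hε : 0 < (Tbar - M * C) / (M + 1) := div_pos (by linarith) (by linarith)
  filter_upwards [heisAnisoThermalRiemannSum_one_zero_eventually_le hd3 hK hε] with k hk
  have h1 := heisAnisoThermalRiemannSum_le_mul_one_zero (fun i => (hK i).le) t μ (2 * k)
  have h2 : M * heisAnisoThermalRiemannSum K 1 0 (2 * k) ≤ M * (C + (Tbar - M * C) / (M + 1)) :=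
    mul_le_mul_of_nonneg_left hk hM
  have h3 : M * ((Tbar - M * C) / (M + 1)) ≤ Tbar - M * C := by
    rw [← mul_div_assoc, div_le_iff₀ (by linarith)]
    nlinarith
  have h4 : M * (C + (Tbar - M * C) / (M + 1)) ≤ Tbar := by
    rw [mul_add]
    linarith
  exact h1.trans (h2.trans h4)

end ThermalSum

/-! ### Néel order at inverse temperature `β` from certified integrals -/

section Order

/-- **Néel long-range order of the model (5) at inverse temperature `β` from certified values of
the integrals** (`d ≥ 3`): if `K > 0`, `β > 0`, and finitely many quadruples `(tⱼ, μⱼ, W̄ⱼ, T̄ⱼ)`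
with `tⱼ - Σᵢμⱼᵢ > 0`, `𝓘^K_{tⱼ,μⱼ} < W̄ⱼ` and `({tⱼ}₊ + Σᵢ|μⱼᵢ|)·C₀(K) < T̄ⱼ`, together with a margin
`δ`, satisfy the real-arithmetic certificate "every `ε` with (T) `|εᵢ| ≤ S²` and (Nᵀ)
`ΣᵢKᵢεᵢ ≤ -(S²/3)ΣᵢKᵢ + log(n+1)/(3β)` admits `j` with
`δ(tⱼ - Σᵢμⱼᵢ) ≤ tⱼS(S+1)/3 + Σᵢμⱼᵢεᵢ - (S²/2)^{1/2}W̄ⱼ - T̄ⱼ/(2β)`", then along the even tori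
`(ℤ/(2k+2)ℤ)^d` the thermal staggered order parameter satisfies
`liminf |Λ|⁻² Σ_{x,y}(-1)^{x+y}⟨𝐒_x·𝐒_y⟩_β ≥ 3δ` — the positive-temperature phase transition for the
model (5) announced on [KLS1988JSP] p. 1020, with its numerical step as the explicit input.
[cite: KLS1988JSP, p. 1020, eqs. (5)-(9), p. 1023] [cite: DLS1978, Thms. 5.1, 6.2] -/
theorem heisAniso_thermal_neelLRO_of_integral_certificate (hd3 : 3 ≤ d) {n : ℕ} {K : Fin d → ℝ}
    (hK : ∀ i, 0 < K i) {β : ℝ} (hβ : 0 < β) {ι : Type*} (J : Finset ι) (t : ι → ℝ)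
    (μ : ι → Fin d → ℝ) (Wbar Tbar : ι → ℝ) (hpos : ∀ j ∈ J, 0 < t j - ∑ i, μ j i)
    (hI : ∀ j ∈ J, heisAnisoKlsIntegral K (t j) (μ j) < Wbar j)
    (hC : ∀ j ∈ J, (max (t j) 0 + ∑ i, |μ j i|) * AnisotropicRotator.infraredConstant K < Tbar j)
    {δ : ℝ}
    (hcert : ∀ ε : Fin d → ℝ, (∀ i, |ε i| ≤ ((n : ℝ) / 2) ^ 2) →
      (∑ i, K i * ε i ≤ -(((n : ℝ) / 2) ^ 2 / 3) * ∑ i, K i + Real.log (n + 1) / (3 * β)) →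
      ∃ j ∈ J, δ * (t j - ∑ i, μ j i) ≤
        t j * ((n : ℝ) / 2 * ((n : ℝ) / 2 + 1) / 3) + ∑ i, μ j i * ε i -
          Real.sqrt (((n : ℝ) / 2) ^ 2 / 2) * Wbar j - 1 / (2 * β) * Tbar j) :
    3 * δ ≤ liminf (fun k : ℕ =>
      (∑ x : TorusSite d (2 * k + 2), ∑ y : TorusSite d (2 * k + 2),
        (-1 : ℝ) ^ (∑ i, (x i).val) * (-1) ^ (∑ i, (y i).val) *
          ∑ α : Fin 3, gibbsSpinCorr β (heisAnisoTorus (2 * k + 2) n K) α x y) /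
        ((2 * k + 2 : ℕ) : ℝ) ^ (2 * d)) atTop :=
  heisAniso_thermal_neelLRO_of_certificate hK hβ J t μ Wbar Tbar hpos
    (fun j hj => heisAnisoKlsRiemannSum_eventually_le hd3 hK (t j) (μ j) (hI j hj))
    (fun j hj => heisAnisoThermalRiemannSum_eventually_le hd3 hK (t j) (μ j) (hC j hj)) hcert

end Order

/-! ### Large spin: Néel order at positive temperature, unconditionally -/

section LargeSpin

/-- **The thermal Néel order parameter of the antiferromagnet with direction-dependent couplings,
large spin** (`d = 3`, `K > 0`, `2Kᵢ ≤ ΣⱼKⱼ`, every spin `S = n/2`, every `β > 0`): along the even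
tori `(ℤ/(2k+2)ℤ)³`,
`liminf_k |Λ_k|⁻² Σ_{x,y} (-1)^{x+y} ⟨𝐒_x·𝐒_y⟩_β ≥ S(S+1) - 9S/√2 - 3C₀(K)/(2β)`,
`C₀(K) = (2π)⁻³∫d³p/E^K_p` — the two-sum-rule bound at `(t, μ) = (1, 0)` (Dyson–Lieb–Simon's use of
the total sum rule) with `W̄ = 3` (`heisAnisoKlsIntegral_one_zero_lt_three`), the worst case
`-εᵢ(β) ≤ S²` of (T), and `T̄ = C₀(K) + η` for every `η > 0`. [DLS1978] Thm. 6.2 for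
direction-dependent couplings, with an explicit (crude) constant.
[cite: DLS1978, Thms. 5.1, 6.2] [cite: KLS1988JSP, p. 1020, §3] [cite: FILS1978, eq. (4.7)] -/
theorem heisAniso_thermalNeelOrderParameter_ge_three {K : Fin 3 → ℝ} (hK : ∀ i, 0 < K i)
    (h2 : ∀ i, 2 * K i ≤ ∑ j, K j) (n : ℕ) {β : ℝ} (hβ : 0 < β) :
    (n : ℝ) / 2 * ((n : ℝ) / 2 + 1) - 9 * ((n : ℝ) / 2) / Real.sqrt 2 -
        3 * AnisotropicRotator.infraredConstant K / (2 * β) ≤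
      liminf (fun k : ℕ =>
        (∑ x : TorusSite 3 (2 * k + 2), ∑ y : TorusSite 3 (2 * k + 2),
          (-1 : ℝ) ^ (∑ i, (x i).val) * (-1) ^ (∑ i, (y i).val) *
            ∑ α : Fin 3, gibbsSpinCorr β (heisAnisoTorus (2 * k + 2) n K) α x y) /
          ((2 * k + 2 : ℕ) : ℝ) ^ (2 * 3)) atTop := by
  have hS0 : 0 ≤ (n : ℝ) / 2 := by positivity
  have hI : heisAnisoKlsIntegral K 1 0 < 3 := heisAnisoKlsIntegral_one_zero_lt_three hK h2
  have hs2 : Real.sqrt 2 ≠ 0 := (Real.sqrt_pos.2 (by norm_num : (0 : ℝ) < 2)).ne'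
  have hβ0 : β ≠ 0 := hβ.ne'
  set C : ℝ := AnisotropicRotator.infraredConstant K with hC_def
  refine le_of_forall_pos_le_add fun ε hε => ?_
  have hη : 0 < 2 * β * ε / 3 := by positivity
  have h := heisAniso_thermal_neelLRO_of_integral_certificate (n := n) (le_refl 3) hK hβ
    (Finset.univ : Finset Unit) (fun _ => (1 : ℝ)) (fun _ => (0 : Fin 3 → ℝ)) (fun _ => (3 : ℝ))
    (fun _ => C + 2 * β * ε / 3)
    (fun _ _ => by simp) (fun _ _ => hI)
    (fun _ _ => by
      have e : (max (1 : ℝ) 0 + ∑ i : Fin 3, |(0 : Fin 3 → ℝ) i|) = 1 := by simp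
      rw [e, one_mul]
      linarith)
    (δ := (n : ℝ) / 2 * ((n : ℝ) / 2 + 1) / 3 - 3 * ((n : ℝ) / 2) / Real.sqrt 2 -
      (C + 2 * β * ε / 3) / (2 * β))
    (fun e hTb _ => ⟨(), mem_univ _, by
      have hx : ((n : ℝ) / 2) ^ 2 ≤ ((n : ℝ) / 2) ^ 2 := le_rfl
      have hsq := Real.sqrt_div_two_le hS0 hx
      simp only [Pi.zero_apply, zero_mul, sum_const_zero, sub_zero, mul_one, one_mul, add_zero]
      have h3 : Real.sqrt (((n : ℝ) / 2) ^ 2 / 2) * 3 ≤ 3 * ((n : ℝ) / 2) / Real.sqrt 2 := by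
        rw [mul_comm, mul_div_assoc]
        exact mul_le_mul_of_nonneg_left hsq (by norm_num)
      have h4 : 1 / (2 * β) * (C + 2 * β * ε / 3) = (C + 2 * β * ε / 3) / (2 * β) := by ring
      linarith [h3, h4]⟩)
  have e3 : 3 * ((n : ℝ) / 2 * ((n : ℝ) / 2 + 1) / 3 - 3 * ((n : ℝ) / 2) / Real.sqrt 2 -
      (C + 2 * β * ε / 3) / (2 * β)) =
      (n : ℝ) / 2 * ((n : ℝ) / 2 + 1) - 9 * ((n : ℝ) / 2) / Real.sqrt 2 - 3 * C / (2 * β) - ε := by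
    field_simp
    ring
  linarith [h, e3]

/-- **Néel long-range order at positive temperature for large spin** (`d = 3`, `K > 0`,
`2Kᵢ ≤ ΣⱼKⱼ`): for `S = n/2 ≥ 11/2` and every inverse temperature `β` with
`2β(S(S+1) - 9S/√2) > 3C₀(K)`, the floor `S(S+1) - 9S/√2 - 3C₀(K)/(2β)` is positive, so the
Gibbs states of `H_K` on the even tori have Néel long-range order — [DLS1978] Thm. 6.2
("phase transition at sufficiently low temperature if `ν ≥ 3`, `S = 1, 3/2, …`") for
direction-dependent couplings, with the explicit temperature range and `S ≥ 11/2`.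
[cite: DLS1978, Thm. 6.2] [cite: KLS1988JSP, p. 1020, §3] -/
theorem heisAniso_neelLRO_thermal_largeSpin_three {K : Fin 3 → ℝ} (hK : ∀ i, 0 < K i)
    (h2 : ∀ i, 2 * K i ≤ ∑ j, K j) {n : ℕ} (hn : 11 ≤ n) {β : ℝ}
    (hβ : 3 * AnisotropicRotator.infraredConstant K <
      2 * β * ((n : ℝ) / 2 * ((n : ℝ) / 2 + 1) - 9 * ((n : ℝ) / 2) / Real.sqrt 2)) :
    0 < (n : ℝ) / 2 * ((n : ℝ) / 2 + 1) - 9 * ((n : ℝ) / 2) / Real.sqrt 2 -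
        3 * AnisotropicRotator.infraredConstant K / (2 * β) ∧
      (n : ℝ) / 2 * ((n : ℝ) / 2 + 1) - 9 * ((n : ℝ) / 2) / Real.sqrt 2 -
          3 * AnisotropicRotator.infraredConstant K / (2 * β) ≤
        liminf (fun k : ℕ =>
          (∑ x : TorusSite 3 (2 * k + 2), ∑ y : TorusSite 3 (2 * k + 2),
            (-1 : ℝ) ^ (∑ i, (x i).val) * (-1) ^ (∑ i, (y i).val) *
              ∑ α : Fin 3, gibbsSpinCorr β (heisAnisoTorus (2 * k + 2) n K) α x y) /
            ((2 * k + 2 : ℕ) : ℝ) ^ (2 * 3)) atTop := by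
  set F : ℝ := (n : ℝ) / 2 * ((n : ℝ) / 2 + 1) - 9 * ((n : ℝ) / 2) / Real.sqrt 2 with hF_def
  set C : ℝ := AnisotropicRotator.infraredConstant K with hC_def
  have hF : 0 < F := (layeredHeis_neelLRO_largeSpin one_pos (by norm_num : (1 : ℝ) ≤ 2) hn).1
  -- `C₀(K) ≥ 0` (a nonnegative integrand) and `β > 0`
  have hC0 : 0 ≤ C := by
    rw [hC_def, AnisotropicRotator.infraredConstant]
    refine mul_nonneg (by positivity) (setIntegral_nonneg (measurableSet_brillouin 3) fun p _ => ?_)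
    exact div_nonneg zero_le_one (heisAniso_anisoDispersion_nonneg (fun i => (hK i).le) p)
  have hβpos : 0 < β := by
    have h1 : 0 ≤ 3 * C := by positivity
    have h2' : 0 < 2 * β * F := lt_of_le_of_lt h1 hβ
    rcases pos_and_pos_or_neg_and_neg_of_mul_pos h2' with ⟨h, _⟩ | ⟨_, h⟩
    · linarith
    · exact absurd h (not_lt.2 hF.le)
  refine ⟨?_, heisAniso_thermalNeelOrderParameter_ge_three hK h2 n hβpos⟩
  rw [sub_pos, div_lt_iff₀ (by positivity)]
  linarith

/-! ### The layered model `K = (1, 1, r)`: the interlayer logarithm -/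

/-- **The thermal Néel order parameter of the layered spin-`S` antiferromagnet** ([KLS1988JSP] eq. (5):
`K = (1, 1, r)`, `0 < r ≤ 1`): for every spin `S = n/2` and every `β > 0`, along the even tori
`(ℤ/(2k+2)ℤ)³`, `liminf |Λ|⁻² Σ_{x,y}(-1)^{x+y}⟨𝐒_x·𝐒_y⟩_β ≥ S(S+1) - 9S/√2 - 3C(r)/(2β)` with
Kennedy–Lieb–Shastry's / Fröhlich–Israel–Lieb–Simon's constant `C(r) = (2π)⁻³∫d³q/E^r_q`
(`AnisotropicRotator.klsConstant`; `C(r) ≤ 1 + π/4 + (π/8)log(1/r) ≤ 3 + log(1/r)` by the tree's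
`klsConstant_le_sharp` / `klsConstant_le`). [cite: KLS1988JSP, p. 1020, eqs. (5), (7)]
[cite: DLS1978, Thm. 6.2] [cite: FILS1978, eq. (4.7)] -/
theorem layeredHeis_thermalNeelOrderParameter_ge {r : ℝ} (hr0 : 0 < r) (hr1 : r ≤ 1) (n : ℕ)
    {β : ℝ} (hβ : 0 < β) :
    (n : ℝ) / 2 * ((n : ℝ) / 2 + 1) - 9 * ((n : ℝ) / 2) / Real.sqrt 2 -
        3 * AnisotropicRotator.klsConstant r / (2 * β) ≤
      liminf (fun k : ℕ =>
        (∑ x : TorusSite 3 (2 * k + 2), ∑ y : TorusSite 3 (2 * k + 2),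
          (-1 : ℝ) ^ (∑ i, (x i).val) * (-1) ^ (∑ i, (y i).val) *
            ∑ α : Fin 3, gibbsSpinCorr β (heisAnisoTorus (2 * k + 2) n ![(1 : ℝ), 1, r]) α x y) /
          ((2 * k + 2 : ℕ) : ℝ) ^ (2 * 3)) atTop := by
  have hsum : ∑ j, ![(1 : ℝ), 1, r] j = 2 + r := by
    rw [Fin.sum_univ_three]
    show (1 : ℝ) + 1 + r = 2 + r
    ring
  have hK : ∀ i, 0 < ![(1 : ℝ), 1, r] i := by
    intro i
    fin_cases i
    · show (0 : ℝ) < 1; norm_num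
    · show (0 : ℝ) < 1; norm_num
    · show (0 : ℝ) < r; exact hr0
  have h2 : ∀ i, 2 * ![(1 : ℝ), 1, r] i ≤ ∑ j, ![(1 : ℝ), 1, r] j := by
    intro i
    rw [hsum]
    fin_cases i
    · show 2 * (1 : ℝ) ≤ 2 + r; linarith
    · show 2 * (1 : ℝ) ≤ 2 + r; linarith
    · show 2 * r ≤ 2 + r; linarith
  have hC : AnisotropicRotator.infraredConstant ![(1 : ℝ), 1, r] =
      AnisotropicRotator.klsConstant r := by
    rw [← layeredCoupling_one_eq, AnisotropicRotator.infraredConstant_layeredCoupling one_ne_zero,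
      div_one, div_one]
  have h := heisAniso_thermalNeelOrderParameter_ge_three hK h2 n hβ
  rw [hC] at h
  exact h

/-- **The same with the explicit interlayer logarithm**: for `0 < r ≤ 1`, every spin and `β > 0`,
`liminf |Λ|⁻² Σ_{x,y}(-1)^{x+y}⟨𝐒_x·𝐒_y⟩_β ≥ S(S+1) - 9S/√2 - 3(3 + log(1/r))/(2β)`
(`klsConstant_le`). [cite: KLS1988JSP, p. 1020, eqs. (5), (7)] [cite: DLS1978, Thm. 6.2]
[cite: FILS1978, eq. (4.7)] -/
theorem layeredHeis_thermalNeelOrderParameter_ge_explicit {r : ℝ} (hr0 : 0 < r) (hr1 : r ≤ 1)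
    (n : ℕ) {β : ℝ} (hβ : 0 < β) :
    (n : ℝ) / 2 * ((n : ℝ) / 2 + 1) - 9 * ((n : ℝ) / 2) / Real.sqrt 2 -
        3 * (3 + Real.log (1 / r)) / (2 * β) ≤
      liminf (fun k : ℕ =>
        (∑ x : TorusSite 3 (2 * k + 2), ∑ y : TorusSite 3 (2 * k + 2),
          (-1 : ℝ) ^ (∑ i, (x i).val) * (-1) ^ (∑ i, (y i).val) *
            ∑ α : Fin 3, gibbsSpinCorr β (heisAnisoTorus (2 * k + 2) n ![(1 : ℝ), 1, r]) α x y) /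
          ((2 * k + 2 : ℕ) : ℝ) ^ (2 * 3)) atTop := by
  have h := layeredHeis_thermalNeelOrderParameter_ge hr0 hr1 n hβ
  have hCle := AnisotropicRotator.klsConstant_le hr0 hr1
  have hdiv : 3 * AnisotropicRotator.klsConstant r / (2 * β) ≤
      3 * (3 + Real.log (1 / r)) / (2 * β) :=
    div_le_div_of_nonneg_right (by linarith) (by positivity)
  linarith

/-- **Néel long-range order of the layered spin-`S` antiferromagnet at positive temperature,
unconditionally, with the interlayer logarithm** ([KLS1988JSP] p. 1020's combination with
[DLS1978], large-spin regime): for `K = (1, 1, r)`, `0 < r ≤ 1`, every spin `S = n/2 ≥ 11/2` and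
every inverse temperature `β` with `2β(S(S+1) - 9S/√2) > 3(3 + log(1/r))`, the floor
`S(S+1) - 9S/√2 - 3(3 + log(1/r))/(2β)` is positive and bounds the thermal staggered order
parameter from below along the even tori `(ℤ/(2k+2)ℤ)³`. In units of the in-plane coupling `J∥`
with interlayer coupling `J⊥ = rJ∥ ≤ J∥`: Néel order for all temperatures
`k_BT < (2/3)·J∥·(S(S+1) - 9S/√2)/(3 + log(J∥/J⊥))` — an explicit `1/log(J∥/J⊥)` Néel-temperature
floor for quasi-two-dimensional large-spin antiferromagnets (crude constant; `S = ½` is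
[KLS1988JSP]'s numerical regime `r ≥ 0.16`, left to the certificate form
`heisAniso_thermal_neelLRO_of_integral_certificate`).
[cite: KLS1988JSP, p. 1020, §3, eq. (5)] [cite: DLS1978, Thm. 6.2] [cite: FILS1978, eq. (4.7), Thm. 4.7] -/
theorem layeredHeis_neelLRO_thermal_largeSpin {r : ℝ} (hr0 : 0 < r) (hr1 : r ≤ 1) {n : ℕ}
    (hn : 11 ≤ n) {β : ℝ}
    (hβ : 3 * (3 + Real.log (1 / r)) <
      2 * β * ((n : ℝ) / 2 * ((n : ℝ) / 2 + 1) - 9 * ((n : ℝ) / 2) / Real.sqrt 2)) :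
    0 < (n : ℝ) / 2 * ((n : ℝ) / 2 + 1) - 9 * ((n : ℝ) / 2) / Real.sqrt 2 -
        3 * (3 + Real.log (1 / r)) / (2 * β) ∧
      (n : ℝ) / 2 * ((n : ℝ) / 2 + 1) - 9 * ((n : ℝ) / 2) / Real.sqrt 2 -
          3 * (3 + Real.log (1 / r)) / (2 * β) ≤
        liminf (fun k : ℕ =>
          (∑ x : TorusSite 3 (2 * k + 2), ∑ y : TorusSite 3 (2 * k + 2),
            (-1 : ℝ) ^ (∑ i, (x i).val) * (-1) ^ (∑ i, (y i).val) *
              ∑ α : Fin 3, gibbsSpinCorr β (heisAnisoTorus (2 * k + 2) n ![(1 : ℝ), 1, r]) α x y) /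
            ((2 * k + 2 : ℕ) : ℝ) ^ (2 * 3)) atTop := by
  set F : ℝ := (n : ℝ) / 2 * ((n : ℝ) / 2 + 1) - 9 * ((n : ℝ) / 2) / Real.sqrt 2 with hF_def
  have hF : 0 < F := (layeredHeis_neelLRO_largeSpin hr0 (by linarith : r ≤ 2) hn).1
  have hlog : 0 ≤ Real.log (1 / r) := Real.log_nonneg (by rw [le_div_iff₀ hr0]; linarith)
  have hβpos : 0 < β := by
    have h1 : 0 < 3 * (3 + Real.log (1 / r)) := by linarith
    have h2' : 0 < 2 * β * F := h1.trans hβ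
    rcases pos_and_pos_or_neg_and_neg_of_mul_pos h2' with ⟨h, _⟩ | ⟨_, h⟩
    · linarith
    · exact absurd h (not_lt.2 hF.le)
  refine ⟨?_, layeredHeis_thermalNeelOrderParameter_ge_explicit hr0 hr1 n hβpos⟩
  rw [sub_pos, div_lt_iff₀ (by positivity)]
  linarith

end LargeSpin

end Literature.MathematicalPhysics.QuantumLattice
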